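import Summits.AtomisticToContinuum.HydrodynamicLimit.Theorems.InformationPercolationEngineChaosClosesEulerShellField
import HarnessLib

/-!
# BF18 shell for functions (crux `ChaosClosesEuler`, stmt-AtomisticToContinuum-15141, line `Sketch`,
# stub `stub_bf18Shell`) — the shell field's slice functions, part 2 (`stub_bf18ShellFieldB`)

WHAT. Continuation of `…ChaosClosesEulerShellField` (same setting: a measurable bounded shell field
`V = (ϱ, m, E) : ℝ → 𝕋³ → ℝ × E³ × ℝ`, `ϱ, E ≥ 0`, `|m|² ≤ 2ϱE`, `|ϱ|, |m|, |E| ≤ CV`, against a classical solution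
`(ρ, u, θ)` on `[0, T)` for `eos = EulerEOS.monatomicExcess χe f`, point data `pdAt T ρ u θ`, shell state
`w(V s x) = (ϱ, E - |m|²/(2ϱ), m)`, cold/warm selected cut-off, `S = [0, t'] × 𝕋³`, `t' < T`):

* §1 `exists_measurable_slice` (= the registered `stub_bf18ShellFieldB`): `s ↦ ∫ₓ h(s, x)` has a measurable version
  on `[0, t']` whenever the modification of `h` off `S` by `0` is measurable (`measurable_integral_slice`);
* §3' measurability off `S` and explicit bounds on `S` (in `CV, M, N, B, max |a| |b|`, or a field bound `P`) of the
  remaining integrands of the shell: the (H2) integrand (= `momI` at the shell state, `field_momI`), `contI`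
  (`field_contI`), the (H3) pieces (= `entI` with the selected cut-off, `field_entI`) and `θ̃ ϱ Zs`, the data
  `∂ₜp̃`, `div(p̃ũ)`, `p̃` (`field_data`), the linear pieces `E`, `ũ·m`, `φ₁ϱ` of `ℰ` (`field_linear`), and the
  `L¹` error (`field_L1`) — hence, by `slice_pack`, their slice functions.

WHY. The `V`-dependent integrability inputs of the assembly of `stub_bf18Shell` (the pieces `XE, XM, XC, XS, XP` of
`F` and `GM, GC, GS, GP, GD` of `∫ₓ (rawRHS + div)` in the weighted bookkeeping `stub_bf18ShellWin`); the splitting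
identities themselves are in the companion file `…ShellFieldC`.

No named fact is invoked.
-/

noncomputable section

namespace Summit.AtomisticToContinuum.HydrodynamicLimit.Theorems.ChaosClosesEulerShellFieldB

open Set MeasureTheory Function Literature.Analysis.FluidPDE Literature.Analysis.FluidPDE.CompressibleEuler
  Literature.Analysis.FluidPDE.CompressibleEuler.StrongPointData Literature.Analysis.FluidPDE.CompressibleEuler.EulerPhase
  Literature.Analysis.FunctionSpaces
open Summit.AtomisticToContinuum.HydrodynamicLimit.Theorems.ChaosClosesEulerShellMeas
  Summit.AtomisticToContinuum.HydrodynamicLimit.Theorems.ChaosClosesEulerShellSlice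
  Summit.AtomisticToContinuum.HydrodynamicLimit.Theorems.ChaosClosesEulerShellField
open Literature.MathematicalPhysics.KineticTheory (T3 V3 totalEnergyDensity)
open scoped InnerProductSpace

/-! ## §1 Measurable version of a slice integral -/

section Slices

/-- **Measurable version of the slice integral.** If the modification of `h` off `[0, t'] × 𝕋³` by `0` is
measurable, `s ↦ ∫ₓ h(s, x)` agrees on `[0, t']` with a measurable function (the slice integral of the
modification, `measurable_integral_slice`). [folklore] -/
theorem exists_measurable_slice (h : ℝ × T3 → ℝ) (t' : ℝ) (hm : Measurable ((Icc 0 t' ×ˢ univ).piecewise h 0)) :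
    ∃ Fm : ℝ → ℝ, Measurable Fm ∧ ∀ s ∈ Icc 0 t', Fm s = ∫ x, h (s, x) := by
  refine ⟨fun s => ∫ x, (Icc 0 t' ×ˢ (univ : Set T3)).piecewise h 0 (s, x), measurable_integral_slice hm,
    fun s hs => integral_congr_ae (ae_of_all _ fun x => ?_)⟩
  have hz : (s, x) ∈ Icc 0 t' ×ˢ (univ : Set T3) := ⟨hs, mem_univ x⟩
  exact piecewise_eq_of_mem _ _ _ hz

end Slices

/-! ## §3' The remaining integrands of the shell: measurability off `S` and bounds on `S` -/

section Field

variable {χe f : ℝ → ℝ} {B T t' CV M N a b : ℝ} {ρ θ : ℝ → T3 → ℝ} {u : ℝ → T3 → V3}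
  {V : ℝ → T3 → ℝ × V3 × ℝ}

/-- **(iii) The (H2) integrand `∂ₜũ·m + ∑ᵢⱼ ∂ⱼũᵢ (mᵢmⱼ/ϱ + δᵢⱼ pV)`** is the tree's `momI` at the shell state
(`momI_shell`, the point data carry `∂ₜũ`, `∂ⱼũᵢ` by definition); measurable modification off `S` and the bound
`(9 + 2B) M · 2CV` on `S` (`abs_momI_shell_le`). [folklore] -/
theorem field_momI (hχc : ContinuousOn χe (Ioi 0)) (hfc : ContinuousOn f (Ioi 0)) (hB : ∀ a, 0 < a → |χe a| ≤ B)
    (hcl : IsClassicalEulerSolution (EulerEOS.monatomicExcess χe f) T ρ u θ) (ht' : t' < T)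
    (hV : Measurable (uncurry V)) (hV0 : ∀ s x, 0 ≤ (V s x).1) (hVE : ∀ s x, 0 ≤ (V s x).2.2)
    (hVm : ∀ s x, ‖(V s x).2.1‖ ^ 2 ≤ 2 * (V s x).1 * (V s x).2.2)
    (hCV : ∀ s x, |(V s x).1| ≤ CV ∧ ‖(V s x).2.1‖ ≤ CV ∧ |(V s x).2.2| ≤ CV)
    (hM : ∀ s ∈ Icc 0 t', ∀ x, (pdAt T ρ u θ (s, x)).Bounded M) :
    (∀ z : ℝ × T3, ⟪Torus.timeDerivWithin (Ico 0 T) u z.1 z.2, (V z.1 z.2).2.1⟫_ℝ +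
        ∑ i : Fin 3, ∑ j : Fin 3, Torus.partialDeriv j (fun y => u z.1 y i) z.2 *
          ((V z.1 z.2).2.1 i * (V z.1 z.2).2.1 j / (V z.1 z.2).1 + if i = j then (V z.1 z.2).1 *
            (2 / 3 * ((V z.1 z.2).2.2 / (V z.1 z.2).1 - ‖(V z.1 z.2).2.1‖ ^ 2 / (2 * (V z.1 z.2).1 ^ 2))) *
            χe (V z.1 z.2).1 else 0) =
      (pdAt T ρ u θ z).momI (EulerEOS.monatomicExcess χe f)
        ((V z.1 z.2).1, (V z.1 z.2).2.2 - ‖(V z.1 z.2).2.1‖ ^ 2 / (2 * (V z.1 z.2).1), (V z.1 z.2).2.1)) ∧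
    Measurable ((Icc 0 t' ×ˢ (univ : Set T3)).piecewise (fun z =>
      ⟪Torus.timeDerivWithin (Ico 0 T) u z.1 z.2, (V z.1 z.2).2.1⟫_ℝ +
        ∑ i : Fin 3, ∑ j : Fin 3, Torus.partialDeriv j (fun y => u z.1 y i) z.2 *
          ((V z.1 z.2).2.1 i * (V z.1 z.2).2.1 j / (V z.1 z.2).1 + if i = j then (V z.1 z.2).1 *
            (2 / 3 * ((V z.1 z.2).2.2 / (V z.1 z.2).1 - ‖(V z.1 z.2).2.1‖ ^ 2 / (2 * (V z.1 z.2).1 ^ 2))) *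
            χe (V z.1 z.2).1 else 0)) 0) ∧
    ∀ z ∈ Icc 0 t' ×ˢ (univ : Set T3), |⟪Torus.timeDerivWithin (Ico 0 T) u z.1 z.2, (V z.1 z.2).2.1⟫_ℝ +
        ∑ i : Fin 3, ∑ j : Fin 3, Torus.partialDeriv j (fun y => u z.1 y i) z.2 *
          ((V z.1 z.2).2.1 i * (V z.1 z.2).2.1 j / (V z.1 z.2).1 + if i = j then (V z.1 z.2).1 *
            (2 / 3 * ((V z.1 z.2).2.2 / (V z.1 z.2).1 - ‖(V z.1 z.2).2.1‖ ^ 2 / (2 * (V z.1 z.2).1 ^ 2))) *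
            χe (V z.1 z.2).1 else 0)| ≤ (9 + 2 * B) * M * (2 * CV) := by
  have hid : ∀ z : ℝ × T3, ⟪Torus.timeDerivWithin (Ico 0 T) u z.1 z.2, (V z.1 z.2).2.1⟫_ℝ +
      ∑ i : Fin 3, ∑ j : Fin 3, Torus.partialDeriv j (fun y => u z.1 y i) z.2 *
        ((V z.1 z.2).2.1 i * (V z.1 z.2).2.1 j / (V z.1 z.2).1 + if i = j then (V z.1 z.2).1 *
          (2 / 3 * ((V z.1 z.2).2.2 / (V z.1 z.2).1 - ‖(V z.1 z.2).2.1‖ ^ 2 / (2 * (V z.1 z.2).1 ^ 2))) *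
          χe (V z.1 z.2).1 else 0) =
      (pdAt T ρ u θ z).momI (EulerEOS.monatomicExcess χe f)
        ((V z.1 z.2).1, (V z.1 z.2).2.2 - ‖(V z.1 z.2).2.1‖ ^ 2 / (2 * (V z.1 z.2).1), (V z.1 z.2).2.1) :=
    fun z => momI_shell χe f (pdAt T ρ u θ z) (V z.1 z.2)
  obtain ⟨mr, mΘ, mrt, mΘt, mU, mUt, mgr, mgΘ, mgU, hr0⟩ := measurable_data_restrict hcl ht'
  refine ⟨hid, ?_, ?_⟩
  · rw [funext hid]
    exact measurable_modify_of_restrict (measurable_pieces (V := fun z : ↥(Icc 0 t' ×ˢ (univ : Set T3)) =>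
      V (z : ℝ × T3).1 (z : ℝ × T3).2) hχc hfc (hV.comp measurable_subtype_coe) (fun z => hV0 _ _) mr mΘ mrt
      mΘt mU mUt mgr mgΘ mgU hr0 (measurable_const : Measurable fun _ : ℝ => (0 : ℝ))).2.1
  · rintro ⟨s, x⟩ ⟨hs, -⟩
    rw [hid]
    dsimp only
    have hd := hM s hs x
    have hM0 : 0 ≤ M := (abs_nonneg _).trans hd.1
    have hB0 : 0 ≤ B := (abs_nonneg _).trans (hB 1 one_pos)
    obtain ⟨h1, -, h3⟩ := hCV s x
    have hU1 : (V s x).1 ≤ CV := (le_abs_self _).trans h1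
    have hU3 : (V s x).2.2 ≤ CV := (le_abs_self _).trans h3
    refine (abs_momI_shell_le f hB hd _ (hV0 s x) (hVE s x) (hVm s x)).trans ?_
    exact mul_le_mul_of_nonneg_left (by linarith) (by positivity)

/-- **(iv) The (H1) integrand `contI(w(V)) = ϱ ∂ₜφ₁ + m·∇φ₁`**: measurable modification off `S` and the bound
`4N · 2CV` on `S`. [folklore] -/
theorem field_contI (hχc : ContinuousOn χe (Ioi 0)) (hfc : ContinuousOn f (Ioi 0))
    (hcl : IsClassicalEulerSolution (EulerEOS.monatomicExcess χe f) T ρ u θ) (ht' : t' < T)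
    (hV : Measurable (uncurry V)) (hV0 : ∀ s x, 0 ≤ (V s x).1) (hVE : ∀ s x, 0 ≤ (V s x).2.2)
    (hVm : ∀ s x, ‖(V s x).2.1‖ ^ 2 ≤ 2 * (V s x).1 * (V s x).2.2)
    (hCV : ∀ s x, |(V s x).1| ≤ CV ∧ ‖(V s x).2.1‖ ≤ CV ∧ |(V s x).2.2| ≤ CV)
    (hN : CoeffBound (EulerEOS.monatomicExcess χe f) T ρ u θ t' N) :
    Measurable ((Icc 0 t' ×ˢ (univ : Set T3)).piecewise (fun z =>
      (pdAt T ρ u θ z).contI (EulerEOS.monatomicExcess χe f)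
        ((V z.1 z.2).1, (V z.1 z.2).2.2 - ‖(V z.1 z.2).2.1‖ ^ 2 / (2 * (V z.1 z.2).1), (V z.1 z.2).2.1)) 0) ∧
    ∀ z ∈ Icc 0 t' ×ˢ (univ : Set T3), |(pdAt T ρ u θ z).contI (EulerEOS.monatomicExcess χe f)
        ((V z.1 z.2).1, (V z.1 z.2).2.2 - ‖(V z.1 z.2).2.1‖ ^ 2 / (2 * (V z.1 z.2).1), (V z.1 z.2).2.1)| ≤
      4 * N * (2 * CV) := by
  obtain ⟨mr, mΘ, mrt, mΘt, mU, mUt, mgr, mgΘ, mgU, hr0⟩ := measurable_data_restrict hcl ht'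
  refine ⟨measurable_modify_of_restrict (measurable_pieces (V := fun z : ↥(Icc 0 t' ×ˢ (univ : Set T3)) =>
      V (z : ℝ × T3).1 (z : ℝ × T3).2) hχc hfc (hV.comp measurable_subtype_coe) (fun z => hV0 _ _) mr mΘ mrt
      mΘt mU mUt mgr mgΘ mgU hr0 (measurable_const : Measurable fun _ : ℝ => (0 : ℝ))).1, ?_⟩
  rintro ⟨s, x⟩ ⟨hs, -⟩
  dsimp only
  obtain ⟨-, hp, -, -, hφ, hgφ, -⟩ := hN s hs x
  have hN0 : 0 ≤ N := (abs_nonneg _).trans hp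
  obtain ⟨h1, -, h3⟩ := hCV s x
  have hU1 : (V s x).1 ≤ CV := (le_abs_self _).trans h1
  have hU3 : (V s x).2.2 ≤ CV := (le_abs_self _).trans h3
  refine (abs_contI_shell_le _ hφ hgφ _ (hV0 s x) (hVE s x) (hVm s x)).trans ?_
  exact mul_le_mul_of_nonneg_left (by linarith) (by positivity)

/-- **(v) The (H3) pieces.** `ϱ Zs ∂ₜθ̃ + Zs m·∇θ̃` is the tree's `entI` with the selected cut-off at the shell
state (`entI_shell`, `cutoff_shell`); it and `θ̃ · (ϱ Zs)` have measurable modifications off `S` and the bounds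
`4 max(|a|,|b|) M · 2CV`, `N · CV · max(|a|,|b|)` on `S`. [folklore] -/
theorem field_entI (hχc : ContinuousOn χe (Ioi 0)) (hfc : ContinuousOn f (Ioi 0))
    (hcl : IsClassicalEulerSolution (EulerEOS.monatomicExcess χe f) T ρ u θ) (ht' : t' < T)
    (hV : Measurable (uncurry V)) (hV0 : ∀ s x, 0 ≤ (V s x).1) (hVE : ∀ s x, 0 ≤ (V s x).2.2)
    (hVm : ∀ s x, ‖(V s x).2.1‖ ^ 2 ≤ 2 * (V s x).1 * (V s x).2.2)
    (hCV : ∀ s x, |(V s x).1| ≤ CV ∧ ‖(V s x).2.1‖ ≤ CV ∧ |(V s x).2.2| ≤ CV)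
    (hM : ∀ s ∈ Icc 0 t', ∀ x, (pdAt T ρ u θ (s, x)).Bounded M)
    (hN : CoeffBound (EulerEOS.monatomicExcess χe f) T ρ u θ t' N) (hab : a ≤ b) :
    (∀ z : ℝ × T3, (V z.1 z.2).1 * (if 0 < 2 / 3 * ((V z.1 z.2).2.2 / (V z.1 z.2).1 -
          ‖(V z.1 z.2).2.1‖ ^ 2 / (2 * (V z.1 z.2).1 ^ 2)) then max a (min (3 / 2 * Real.log (2 / 3 *
          ((V z.1 z.2).2.2 / (V z.1 z.2).1 - ‖(V z.1 z.2).2.1‖ ^ 2 / (2 * (V z.1 z.2).1 ^ 2))) -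
          Real.log (V z.1 z.2).1 - f (V z.1 z.2).1) b) else a) * Torus.timeDerivWithin (Ico 0 T) θ z.1 z.2 +
        (if 0 < 2 / 3 * ((V z.1 z.2).2.2 / (V z.1 z.2).1 - ‖(V z.1 z.2).2.1‖ ^ 2 / (2 * (V z.1 z.2).1 ^ 2)) then
          max a (min (3 / 2 * Real.log (2 / 3 * ((V z.1 z.2).2.2 / (V z.1 z.2).1 -
            ‖(V z.1 z.2).2.1‖ ^ 2 / (2 * (V z.1 z.2).1 ^ 2))) - Real.log (V z.1 z.2).1 - f (V z.1 z.2).1) b) else a) *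
          ⟪(V z.1 z.2).2.1, Torus.gradient (θ z.1) z.2⟫_ℝ =
      (pdAt T ρ u θ z).entI (EulerEOS.monatomicExcess χe f)
        (if 0 < 2 / 3 * ((V z.1 z.2).2.2 / (V z.1 z.2).1 - ‖(V z.1 z.2).2.1‖ ^ 2 / (2 * (V z.1 z.2).1 ^ 2)) then
          clamp a b else fun _ => a)
        ((V z.1 z.2).1, (V z.1 z.2).2.2 - ‖(V z.1 z.2).2.1‖ ^ 2 / (2 * (V z.1 z.2).1), (V z.1 z.2).2.1)) ∧
    Measurable ((Icc 0 t' ×ˢ (univ : Set T3)).piecewise (fun z =>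
      (V z.1 z.2).1 * (if 0 < 2 / 3 * ((V z.1 z.2).2.2 / (V z.1 z.2).1 -
          ‖(V z.1 z.2).2.1‖ ^ 2 / (2 * (V z.1 z.2).1 ^ 2)) then max a (min (3 / 2 * Real.log (2 / 3 *
          ((V z.1 z.2).2.2 / (V z.1 z.2).1 - ‖(V z.1 z.2).2.1‖ ^ 2 / (2 * (V z.1 z.2).1 ^ 2))) -
          Real.log (V z.1 z.2).1 - f (V z.1 z.2).1) b) else a) * Torus.timeDerivWithin (Ico 0 T) θ z.1 z.2 +
        (if 0 < 2 / 3 * ((V z.1 z.2).2.2 / (V z.1 z.2).1 - ‖(V z.1 z.2).2.1‖ ^ 2 / (2 * (V z.1 z.2).1 ^ 2)) then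
          max a (min (3 / 2 * Real.log (2 / 3 * ((V z.1 z.2).2.2 / (V z.1 z.2).1 -
            ‖(V z.1 z.2).2.1‖ ^ 2 / (2 * (V z.1 z.2).1 ^ 2))) - Real.log (V z.1 z.2).1 - f (V z.1 z.2).1) b) else a) *
          ⟪(V z.1 z.2).2.1, Torus.gradient (θ z.1) z.2⟫_ℝ) 0) ∧
    (∀ z ∈ Icc 0 t' ×ˢ (univ : Set T3), |(V z.1 z.2).1 * (if 0 < 2 / 3 * ((V z.1 z.2).2.2 / (V z.1 z.2).1 -
          ‖(V z.1 z.2).2.1‖ ^ 2 / (2 * (V z.1 z.2).1 ^ 2)) then max a (min (3 / 2 * Real.log (2 / 3 *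
          ((V z.1 z.2).2.2 / (V z.1 z.2).1 - ‖(V z.1 z.2).2.1‖ ^ 2 / (2 * (V z.1 z.2).1 ^ 2))) -
          Real.log (V z.1 z.2).1 - f (V z.1 z.2).1) b) else a) * Torus.timeDerivWithin (Ico 0 T) θ z.1 z.2 +
        (if 0 < 2 / 3 * ((V z.1 z.2).2.2 / (V z.1 z.2).1 - ‖(V z.1 z.2).2.1‖ ^ 2 / (2 * (V z.1 z.2).1 ^ 2)) then
          max a (min (3 / 2 * Real.log (2 / 3 * ((V z.1 z.2).2.2 / (V z.1 z.2).1 -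
            ‖(V z.1 z.2).2.1‖ ^ 2 / (2 * (V z.1 z.2).1 ^ 2))) - Real.log (V z.1 z.2).1 - f (V z.1 z.2).1) b) else a) *
          ⟪(V z.1 z.2).2.1, Torus.gradient (θ z.1) z.2⟫_ℝ| ≤ 4 * max |a| |b| * M * (2 * CV)) ∧
    Measurable ((Icc 0 t' ×ˢ (univ : Set T3)).piecewise (fun z => θ z.1 z.2 * ((V z.1 z.2).1 *
      (if 0 < 2 / 3 * ((V z.1 z.2).2.2 / (V z.1 z.2).1 - ‖(V z.1 z.2).2.1‖ ^ 2 / (2 * (V z.1 z.2).1 ^ 2)) then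
        max a (min (3 / 2 * Real.log (2 / 3 * ((V z.1 z.2).2.2 / (V z.1 z.2).1 -
          ‖(V z.1 z.2).2.1‖ ^ 2 / (2 * (V z.1 z.2).1 ^ 2))) - Real.log (V z.1 z.2).1 - f (V z.1 z.2).1) b) else a))) 0) ∧
    ∀ z ∈ Icc 0 t' ×ˢ (univ : Set T3), |θ z.1 z.2 * ((V z.1 z.2).1 *
      (if 0 < 2 / 3 * ((V z.1 z.2).2.2 / (V z.1 z.2).1 - ‖(V z.1 z.2).2.1‖ ^ 2 / (2 * (V z.1 z.2).1 ^ 2)) then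
        max a (min (3 / 2 * Real.log (2 / 3 * ((V z.1 z.2).2.2 / (V z.1 z.2).1 -
          ‖(V z.1 z.2).2.1‖ ^ 2 / (2 * (V z.1 z.2).1 ^ 2))) - Real.log (V z.1 z.2).1 - f (V z.1 z.2).1) b) else a))| ≤
      N * (CV * max |a| |b|) := by
  -- the identity with `entI`
  have hid : ∀ z : ℝ × T3, (V z.1 z.2).1 * (if 0 < 2 / 3 * ((V z.1 z.2).2.2 / (V z.1 z.2).1 -
          ‖(V z.1 z.2).2.1‖ ^ 2 / (2 * (V z.1 z.2).1 ^ 2)) then max a (min (3 / 2 * Real.log (2 / 3 *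
          ((V z.1 z.2).2.2 / (V z.1 z.2).1 - ‖(V z.1 z.2).2.1‖ ^ 2 / (2 * (V z.1 z.2).1 ^ 2))) -
          Real.log (V z.1 z.2).1 - f (V z.1 z.2).1) b) else a) * Torus.timeDerivWithin (Ico 0 T) θ z.1 z.2 +
        (if 0 < 2 / 3 * ((V z.1 z.2).2.2 / (V z.1 z.2).1 - ‖(V z.1 z.2).2.1‖ ^ 2 / (2 * (V z.1 z.2).1 ^ 2)) then
          max a (min (3 / 2 * Real.log (2 / 3 * ((V z.1 z.2).2.2 / (V z.1 z.2).1 -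
            ‖(V z.1 z.2).2.1‖ ^ 2 / (2 * (V z.1 z.2).1 ^ 2))) - Real.log (V z.1 z.2).1 - f (V z.1 z.2).1) b) else a) *
          ⟪(V z.1 z.2).2.1, Torus.gradient (θ z.1) z.2⟫_ℝ =
      (pdAt T ρ u θ z).entI (EulerEOS.monatomicExcess χe f)
        (if 0 < 2 / 3 * ((V z.1 z.2).2.2 / (V z.1 z.2).1 - ‖(V z.1 z.2).2.1‖ ^ 2 / (2 * (V z.1 z.2).1 ^ 2)) then
          clamp a b else fun _ => a)
        ((V z.1 z.2).1, (V z.1 z.2).2.2 - ‖(V z.1 z.2).2.1‖ ^ 2 / (2 * (V z.1 z.2).1), (V z.1 z.2).2.1) := fun z => by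
    have h1 := entI_shell (EulerEOS.monatomicExcess χe f)
      (if 0 < 2 / 3 * ((V z.1 z.2).2.2 / (V z.1 z.2).1 - ‖(V z.1 z.2).2.1‖ ^ 2 / (2 * (V z.1 z.2).1 ^ 2)) then
        clamp a b else fun _ => a) (pdAt T ρ u θ z) (V z.1 z.2)
    rw [cutoff_shell] at h1
    exact h1
  -- the cut-off is bounded
  have hZs : ∀ U : ℝ × V3 × ℝ, |(if 0 < 2 / 3 * (U.2.2 / U.1 - ‖U.2.1‖ ^ 2 / (2 * U.1 ^ 2)) then
      max a (min (3 / 2 * Real.log (2 / 3 * (U.2.2 / U.1 - ‖U.2.1‖ ^ 2 / (2 * U.1 ^ 2))) - Real.log U.1 - f U.1) b)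
      else a)| ≤ max |a| |b| := fun U => by
    rw [← cutoff_shell χe f a b U]; exact abs_cutoffSel_le hab _ _
  obtain ⟨mr, mΘ, mrt, mΘt, mU, mUt, mgr, mgΘ, mgU, hr0⟩ := measurable_data_restrict hcl ht'
  have hW : Measurable fun z : ↥(Icc 0 t' ×ˢ (univ : Set T3)) => V (z : ℝ × T3).1 (z : ℝ × T3).2 :=
    hV.comp measurable_subtype_coe
  have hZsW := (stub_bf18ShellMeas χe f a b hχc hfc _ hW fun z => hV0 _ _).1
  refine ⟨hid, ?_, ?_, measurable_modify_of_restrict (mΘ.mul (hW.fst.mul hZsW)), ?_⟩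
  · rw [funext hid]
    exact measurable_modify_of_restrict (measurable_pieces_sel (V := fun z : ↥(Icc 0 t' ×ˢ (univ : Set T3)) =>
      V (z : ℝ × T3).1 (z : ℝ × T3).2) hχc hfc hW (fun z => hV0 _ _) mr mΘ mrt mΘt mU mUt mgr mgΘ mgU hr0 a b).2.2
  · rintro ⟨s, x⟩ ⟨hs, -⟩
    rw [hid]
    dsimp only
    have hd := hM s hs x
    have hM0 : 0 ≤ M := (abs_nonneg _).trans hd.1
    have hZb0 : 0 ≤ max |a| |b| := le_max_of_le_left (abs_nonneg a)
    obtain ⟨h1, -, h3⟩ := hCV s x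
    have hU1 : (V s x).1 ≤ CV := (le_abs_self _).trans h1
    have hU3 : (V s x).2.2 ≤ CV := (le_abs_self _).trans h3
    refine (abs_entI_shell_le _ hd (fun σ => abs_cutoffSel_le hab _ σ) _ (hV0 s x) (hVE s x) (hVm s x)).trans ?_
    exact mul_le_mul_of_nonneg_left (by linarith) (by positivity)
  · rintro ⟨s, x⟩ ⟨hs, -⟩
    dsimp only
    obtain ⟨-, -, hΘ, -⟩ := hN s hs x
    obtain ⟨h1, -, -⟩ := hCV s x
    have hU1 : (V s x).1 ≤ CV := (le_abs_self _).trans h1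
    rw [abs_mul, abs_mul, abs_of_nonneg (hV0 s x)]
    exact mul_le_mul hΘ (mul_le_mul hU1 (hZs _) (abs_nonneg _) ((hV0 s x).trans hU1))
      (mul_nonneg (hV0 s x) (abs_nonneg _)) ((abs_nonneg _).trans hΘ)

/-- **(vi), (vii), (xi) Pure data: `∂ₜp̃`, `div(p̃ũ)`, `p̃ = p(ρ, θ)`** — measurable modifications off `S`
(`measurable_coeffs` on the subtype `S`) and the bounds `N`, `6MN`, `N` on `S`. [folklore] -/
theorem field_data (hχc : ContinuousOn χe (Ioi 0)) (hfc : ContinuousOn f (Ioi 0))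
    (hcl : IsClassicalEulerSolution (EulerEOS.monatomicExcess χe f) T ρ u θ) (ht' : t' < T)
    (hM : ∀ s ∈ Icc 0 t', ∀ x, (pdAt T ρ u θ (s, x)).Bounded M)
    (hN : CoeffBound (EulerEOS.monatomicExcess χe f) T ρ u θ t' N) :
    Measurable ((Icc 0 t' ×ˢ (univ : Set T3)).piecewise (fun z => (pdAt T ρ u θ z).pt (EulerEOS.monatomicExcess χe f)) 0) ∧
    (∀ z ∈ Icc 0 t' ×ˢ (univ : Set T3), |(pdAt T ρ u θ z).pt (EulerEOS.monatomicExcess χe f)| ≤ N) ∧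
    Measurable ((Icc 0 t' ×ˢ (univ : Set T3)).piecewise (fun z => divPU (EulerEOS.monatomicExcess χe f) (pdAt T ρ u θ z)) 0) ∧
    (∀ z ∈ Icc 0 t' ×ˢ (univ : Set T3), |divPU (EulerEOS.monatomicExcess χe f) (pdAt T ρ u θ z)| ≤ 6 * M * N) ∧
    Measurable ((Icc 0 t' ×ˢ (univ : Set T3)).piecewise (fun z => (EulerEOS.monatomicExcess χe f).p (ρ z.1 z.2) (θ z.1 z.2)) 0) ∧
    ∀ z ∈ Icc 0 t' ×ˢ (univ : Set T3), |(EulerEOS.monatomicExcess χe f).p (ρ z.1 z.2) (θ z.1 z.2)| ≤ N := by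
  obtain ⟨mr, mΘ, mrt, mΘt, mU, mUt, mgr, mgΘ, mgU, hr0⟩ := measurable_data_restrict hcl ht'
  obtain ⟨-, -, hpt, -, -, -, -, -, -, hdivPU, hp, -⟩ :=
    measurable_coeffs (χe := χe) (f := f) hχc hfc mr mΘ mrt mΘt mU mUt mgr mgΘ mgU hr0
  refine ⟨measurable_modify_of_restrict hpt, fun z hz => (hN z.1 hz.1 z.2).2.2.2.1, measurable_modify_of_restrict hdivPU,
    fun z hz => abs_divPU_le _ (hM z.1 hz.1 z.2) (hN z.1 hz.1 z.2).2.1 (hN z.1 hz.1 z.2).2.2.2.2.2.2,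
    measurable_modify_of_restrict hp, fun z hz => (hN z.1 hz.1 z.2).2.1⟩

/-- **(viii), (ix), (x) The linear pieces of `ℰ`: `E`, `ũ·m`, `φ₁ ϱ`** (`φ₁ = ½|ũ|² - μ(ρ, θ)`,
`energyTestFunction`) — measurable modifications off `S` and the bounds `CV`, `3M · 2CV`, `N · CV` on `S`.
[folklore] -/
theorem field_linear (hχc : ContinuousOn χe (Ioi 0)) (hfc : ContinuousOn f (Ioi 0))
    (hcl : IsClassicalEulerSolution (EulerEOS.monatomicExcess χe f) T ρ u θ) (ht' : t' < T)
    (hV : Measurable (uncurry V)) (hV0 : ∀ s x, 0 ≤ (V s x).1) (hVE : ∀ s x, 0 ≤ (V s x).2.2)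
    (hVm : ∀ s x, ‖(V s x).2.1‖ ^ 2 ≤ 2 * (V s x).1 * (V s x).2.2)
    (hCV : ∀ s x, |(V s x).1| ≤ CV ∧ ‖(V s x).2.1‖ ≤ CV ∧ |(V s x).2.2| ≤ CV)
    (hM : ∀ s ∈ Icc 0 t', ∀ x, (pdAt T ρ u θ (s, x)).Bounded M)
    (hN : CoeffBound (EulerEOS.monatomicExcess χe f) T ρ u θ t' N) :
    Measurable ((Icc 0 t' ×ˢ (univ : Set T3)).piecewise (fun z => (V z.1 z.2).2.2) 0) ∧
    (∀ z ∈ Icc 0 t' ×ˢ (univ : Set T3), |(V z.1 z.2).2.2| ≤ CV) ∧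
    Measurable ((Icc 0 t' ×ˢ (univ : Set T3)).piecewise (fun z => ⟪u z.1 z.2, (V z.1 z.2).2.1⟫_ℝ) 0) ∧
    (∀ z ∈ Icc 0 t' ×ˢ (univ : Set T3), |⟪u z.1 z.2, (V z.1 z.2).2.1⟫_ℝ| ≤ 3 * M * (2 * CV)) ∧
    Measurable ((Icc 0 t' ×ˢ (univ : Set T3)).piecewise (fun z =>
      energyTestFunction (EulerEOS.monatomicExcess χe f) ρ u θ z.1 z.2 * (V z.1 z.2).1) 0) ∧
    ∀ z ∈ Icc 0 t' ×ˢ (univ : Set T3),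
      |energyTestFunction (EulerEOS.monatomicExcess χe f) ρ u θ z.1 z.2 * (V z.1 z.2).1| ≤ N * CV := by
  obtain ⟨mr, mΘ, mrt, mΘt, mU, mUt, mgr, mgΘ, mgU, hr0⟩ := measurable_data_restrict hcl ht'
  obtain ⟨-, -, -, -, -, -, -, -, -, -, -, -, hμ⟩ :=
    measurable_coeffs (χe := χe) (f := f) hχc hfc mr mΘ mrt mΘt mU mUt mgr mgΘ mgU hr0
  have hW : Measurable fun z : ↥(Icc 0 t' ×ˢ (univ : Set T3)) => V (z : ℝ × T3).1 (z : ℝ × T3).2 :=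
    hV.comp measurable_subtype_coe
  refine ⟨measurable_modify_of_restrict hW.snd.snd, fun z _ => (hCV z.1 z.2).2.2,
    measurable_modify_of_restrict (mU.inner hW.snd.fst), ?_,
    measurable_modify_of_restrict ((((mU.norm.pow_const 2).div_const 2).sub hμ).mul hW.fst), ?_⟩
  · rintro ⟨s, x⟩ ⟨hs, -⟩
    dsimp only
    have hd := hM s hs x
    have hM0 : 0 ≤ M := (abs_nonneg _).trans hd.1
    obtain ⟨h1, -, h3⟩ := hCV s x
    have hU1 : (V s x).1 ≤ CV := (le_abs_self _).trans h1
    have hU3 : (V s x).2.2 ≤ CV := (le_abs_self _).trans h3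
    have e : ⟪u s x, (V s x).2.1⟫_ℝ = ∑ i, (V s x).2.1 i * u s x i := by
      rw [inner_eq_sum_mul]; exact Finset.sum_congr rfl fun i _ => mul_comm _ _
    rw [e]
    refine (abs_sum_mom_mul_le hd.2.2.1 _ (hV0 s x) (hVE s x) (hVm s x)).trans ?_
    exact mul_le_mul_of_nonneg_left (by linarith) (by positivity)
  · rintro ⟨s, x⟩ ⟨hs, -⟩
    dsimp only
    obtain ⟨hA, -⟩ := hN s hs x
    obtain ⟨h1, -, -⟩ := hCV s x
    rw [abs_mul, abs_of_nonneg (hV0 s x)]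
    exact mul_le_mul hA ((le_abs_self _).trans h1) (hV0 s x) ((abs_nonneg _).trans hA)

/-- **(xii) The `L¹` error `|ϱ - ρ| + |m - ρũ| + |E - E(ρ, ũ, θ)|`** (`E(ρ, u, θ) = ρ(½|u|² + 3θ/2)`,
`totalEnergyDensity`): measurable modification off `S` and, for fields bounded by `P` on `S`
(`exists_fieldBound`), the bound `3CV + P + P² + P(P²/2 + 3P/2)` there. [folklore] -/
theorem field_L1 (hcl : IsClassicalEulerSolution (EulerEOS.monatomicExcess χe f) T ρ u θ) (ht' : t' < T)
    (hV : Measurable (uncurry V)) (hCV : ∀ s x, |(V s x).1| ≤ CV ∧ ‖(V s x).2.1‖ ≤ CV ∧ |(V s x).2.2| ≤ CV)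
    {P : ℝ} (hρb : ∀ s ∈ Icc 0 t', ∀ x, |ρ s x| ≤ P) (hub : ∀ s ∈ Icc 0 t', ∀ x, ‖u s x‖ ≤ P)
    (hθb : ∀ s ∈ Icc 0 t', ∀ x, |θ s x| ≤ P) :
    Measurable ((Icc 0 t' ×ˢ (univ : Set T3)).piecewise (fun z => |(V z.1 z.2).1 - ρ z.1 z.2| +
      ‖(V z.1 z.2).2.1 - ρ z.1 z.2 • u z.1 z.2‖ +
      |(V z.1 z.2).2.2 - totalEnergyDensity (ρ z.1 z.2) (u z.1 z.2) (θ z.1 z.2)|) 0) ∧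
    ∀ z ∈ Icc 0 t' ×ˢ (univ : Set T3), |(|(V z.1 z.2).1 - ρ z.1 z.2| + ‖(V z.1 z.2).2.1 - ρ z.1 z.2 • u z.1 z.2‖ +
      |(V z.1 z.2).2.2 - totalEnergyDensity (ρ z.1 z.2) (u z.1 z.2) (θ z.1 z.2)|)| ≤
      3 * CV + P + P * P + P * (P ^ 2 / 2 + 3 / 2 * P) := by
  obtain ⟨mr, mΘ, -, -, mU, -⟩ := measurable_data_restrict hcl ht'
  have hW : Measurable fun z : ↥(Icc 0 t' ×ˢ (univ : Set T3)) => V (z : ℝ × T3).1 (z : ℝ × T3).2 :=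
    hV.comp measurable_subtype_coe
  refine ⟨measurable_modify_of_restrict ?_, ?_⟩
  · unfold totalEnergyDensity
    exact ((hW.fst.sub mr).abs.add (hW.snd.fst.sub (mr.smul mU)).norm).add
      (hW.snd.snd.sub (mr.mul (((mU.norm.pow_const 2).div_const 2).add (measurable_const.mul mΘ)))).abs
  · rintro ⟨s, x⟩ ⟨hs, -⟩
    dsimp only
    obtain ⟨h1, h2, h3⟩ := hCV s x
    have hr := hρb s hs x; have hu := hub s hs x; have hθ := hθb s hs x
    have hP0 : 0 ≤ P := (norm_nonneg _).trans hu
    rw [abs_of_nonneg (by positivity)]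
    have e1 : |(V s x).1 - ρ s x| ≤ CV + P := (abs_sub _ _).trans (add_le_add h1 hr)
    have e2 : ‖(V s x).2.1 - ρ s x • u s x‖ ≤ CV + P * P := by
      refine (norm_sub_le _ _).trans (add_le_add h2 ?_)
      rw [norm_smul, Real.norm_eq_abs]; exact mul_le_mul hr hu (norm_nonneg _) hP0
    have e3 : |(V s x).2.2 - totalEnergyDensity (ρ s x) (u s x) (θ s x)| ≤ CV + P * (P ^ 2 / 2 + 3 / 2 * P) := by
      refine (abs_sub _ _).trans (add_le_add h3 ?_)
      unfold totalEnergyDensity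
      rw [abs_mul]
      refine mul_le_mul hr ((abs_add_le _ _).trans (add_le_add ?_ ?_)) (abs_nonneg _) hP0
      · rw [abs_of_nonneg (by positivity)]
        exact div_le_div_of_nonneg_right (pow_le_pow_left₀ (norm_nonneg _) hu 2) two_pos.le
      · rw [abs_mul, abs_of_pos (by norm_num : (0 : ℝ) < 3 / 2)]; exact mul_le_mul_of_nonneg_left hθ (by norm_num)
    linarith

end Field

/-! ## The registered sub-goal -/

/-- REGISTERED SUB-GOAL `stub_bf18ShellFieldB` of the line `Sketch` (BF18 shell, slice functions of the shell field,
part 2): the slice integral `s ↦ ∫ₓ h(s, x)` of a function whose modification off `[0, t'] × 𝕋³` by `0` is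
measurable agrees on `[0, t']` with a measurable function (`exists_measurable_slice`). [folklore] -/
theorem stub_bf18ShellFieldB : ∀ (h : ℝ × UnitAddTorus (Fin 3) → ℝ) (t' : ℝ), Measurable ((Set.Icc 0 t' ×ˢ Set.univ).piecewise h 0) → ∃ Fm : ℝ → ℝ, Measurable Fm ∧ ∀ s ∈ Set.Icc 0 t', Fm s = ∫ x, h (s, x) :=
  fun h t' hm => exists_measurable_slice h t' hm

end Summit.AtomisticToContinuum.HydrodynamicLimit.Theorems.ChaosClosesEulerShellFieldB

end
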